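import Mathlib
import HarnessLib
import Summits.NavierStokesRegularity.NavierStokesRegularity.Theorems.PoloidalWindowDoorLrcModEntireCaseIIEntrance
import Summits.NavierStokesRegularity.NavierStokesRegularity.Theorems.PoloidalWindowDoorLrcModEntireWebPackageAnalytic

/-!
# Route `PoloidalWindowDoor`, item `LrcModEntire` (stmt-NavierStokesRegularity-20428), cell (Q4-sonic, straight, μ < 0) `stub_Q4sonicLineNeg` —
# CASE II ENTRANCE, SHARPENED: the curved END may assume a PUNCTURED WINDOW of non-sonic times

Cell ns-regularity-ideate, stub-worker seat ns-poloidal-K2-p2 g17 under the LEAD of item 20428 (ns-poloidal-K2-p3 g17; T2B-g17 §1 «(I) every nearby time is sonic,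
or (II) the sonic times are ISOLATED»); `--supports stmt-NavierStokesRegularity-20428 --as helper`.

★★ `caseII_false_of_curvedEnd'` — the same reduction as `…CaseIIEntrance.caseII_false_of_curvedEnd` (conclusion: the v14 child `stub_Q4sonicLineNegIsolated`
VERBATIM), with the ISOLATION hypothesis of the END upgraded from «non-sonic times accumulate at `0`» to «EVERY `τ` with `0 < |τ| < δ″` is non-sonic» by the
real-analyticity of the ridge height (`…WebPackageAnalytic.eventually_nonsonic_of_package`: joint analyticity of the class profile, the analytic implicit function
at the non-degenerate maximiser, the identity theorem in `τ`).

WHAT THIS IS NOT: not a claim about Navier–Stokes regularity; closes nothing (types the research residue of the slot more sharply); items 20428 / 19708 / 27893 OPEN.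
-/

noncomputable section

set_option linter.dupNamespace false
set_option linter.style.longLine false

namespace Summit.NavierStokesRegularity.NavierStokesRegularity.Theorems.PoloidalWindowDoorLrcModEntireCaseIIEntranceSharp

open Set Function Filter Topology Metric
open scoped RealInnerProductSpace InnerProductSpace ContDiff Laplacian
open Literature.Analysis Literature.Analysis.FluidPDE Literature.Analysis.UnboundedOperators
open Summit.NavierStokesRegularity.NavierStokesRegularity.Theorems.LocalSineTubeDoorProfileAlignedWindowRigidityAncient
open Summit.NavierStokesRegularity.NavierStokesRegularity.Theorems.PoloidalWindowDoorPoloidalWindowRigidityWindow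
open Summit.NavierStokesRegularity.NavierStokesRegularity.Theorems.PoloidalWindowDoorLrcModEntireSheetFlattenTools
open Summit.NavierStokesRegularity.NavierStokesRegularity.Theorems.PoloidalWindowDoorLrcModEntireCaseIIEntrance
open Summit.NavierStokesRegularity.NavierStokesRegularity.Theorems.PoloidalWindowDoorLrcModEntireWebPackageAnalytic

/-- ★★ **CASE II OF `stub_Q4sonicLineNeg` REDUCES TO THE CURVED END WITH A PUNCTURED WINDOW OF NON-SONIC TIMES.**  As `caseII_false_of_curvedEnd`, with the
isolation hypothesis of the END in the sharpened form `∃ δ″ > 0, ∀ τ, 0 < |τ| < δ″ → R(τ,·)` not affine on `|z| < δ`. -/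
theorem caseII_false_of_curvedEnd'
    (hCurvedEnd' : ∀ (C σ κ ρ δ' r δ m : ℝ) (U : ℝ → EuclideanSpace ℝ (Fin 3) → EuclideanSpace ℝ (Fin 3)) (R μ : ℝ → ℝ → ℝ)
      (e : EuclideanSpace ℝ (Fin 3)) (n₀ : ℝ × ℝ × ℝ → ℝ) (κt : ℝ → ℝ → ℝ),
      -- the hull element: class, hot value, Type-I hot bound, flat hot spot, time normalisation, peakless slices, critical hot set, (TH) structure
      Literature.Analysis.FluidPDE.HasTypeITimeDecay C U →
      ContinuousOn (Function.uncurry U) (Set.Iio (0 : ℝ) ×ˢ Set.univ) →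
      (∀ s t : ℝ, s < t → t < 0 → ∀ x, U t x =
        Literature.Analysis.UnboundedOperators.heatExtension (U s) (t - s) x - Literature.Analysis.FluidPDE.oseenDuhamel 1 s U U t x) →
      (∀ t < 0, Literature.Analysis.FluidPDE.VectorCalculus.IsDivFree (U t)) →
      (∀ s < 0, ∀ q, ⟪Literature.Analysis.FluidPDE.curl (U s) q, EuclideanSpace.single 2 1⟫_ℝ = 0) →
      U (-1) 0 2 ≠ 0 → (∀ t < 0, ∀ x, Real.sqrt (-t) * |U t x 2| ≤ |U (-1) 0 2|) →
      (∀ h : EuclideanSpace ℝ (Fin 3), fderiv ℝ (U (-1)) 0 h 2 = 0) →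
      (deriv (fun s => U s 0 2) (-1) = U (-1) 0 2 / 2 ∧ U (-1) 0 2 * (Δ (fun q => U (-1) q 2)) 0 ≤ 0) →
      (∀ (s z₀ σ M : ℝ) (K O : Set (EuclideanSpace ℝ (Fin 3))), s < 0 →
        ((σ = 1 ∨ σ = -1) ∧ IsCompact K ∧ K.Nonempty ∧ (∀ q ∈ K, q 2 = z₀ ∧ σ * U s q 2 = M) ∧
          IsOpen O ∧ K ⊆ O ∧ (∀ q ∈ O, q 2 = z₀ → σ * U s q 2 ≤ M) ∧
          (∀ q ∈ O, q 2 = z₀ → σ * U s q 2 = M → q ∈ K)) → False) →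
      (∀ y ∈ {y : EuclideanSpace ℝ (Fin 3) | y 2 = 0 ∧ U (-1) y 2 = U (-1) 0 2}, fderiv ℝ (fun x => U (-1) x 2) y = 0) →
      (∀ t < 0, ∀ x x' : EuclideanSpace ℝ (Fin 3), x 2 = x' 2 → ∀ b c : Fin 3, b ≠ 2 → c ≠ 2 →
        fderiv ℝ (U t) x (EuclideanSpace.single 2 1) b * fderiv ℝ (U t) x' (EuclideanSpace.single c 1) 2 =
          fderiv ℝ (U t) x' (EuclideanSpace.single 2 1) c * fderiv ℝ (U t) x (EuclideanSpace.single b 1) 2) →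
      (∀ s < 0, ∀ y, ⟪fderiv ℝ (U s) y (Literature.Analysis.FluidPDE.curl (U s) y), EuclideanSpace.single 2 1⟫_ℝ = 0) →
      -- sign, curvature scale, slope function, slab law (pointwise and eventually form), radii
      (σ = 1 ∨ σ = -1) → σ * U (-1) 0 2 = |U (-1) 0 2| → 0 < κ → ContDiff ℝ 3 (Function.uncurry μ) → 0 < ρ → ρ ≤ 1 →
      (∀ t : ℝ, |t + 1| < ρ → ∀ x : EuclideanSpace ℝ (Fin 3), |x 2| < ρ → ∀ b : Fin 3, b ≠ 2 →
        fderiv ℝ (U t) x (EuclideanSpace.single 2 1) b = μ t (x 2) * fderiv ℝ (U t) x (EuclideanSpace.single b 1) 2) →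
      (∀ t₀ : ℝ, |t₀ + 1| < ρ → ∀ y₀ : EuclideanSpace ℝ (Fin 3), y₀ 2 = 0 →
        ∀ᶠ z in 𝓝 ((t₀, y₀) : ℝ × EuclideanSpace ℝ (Fin 3)), ∀ b : Fin 3, b ≠ 2 →
          fderiv ℝ (U z.1) z.2 (EuclideanSpace.single 2 1) b = μ z.1 (z.2 2) * fderiv ℝ (U z.1) z.2 (EuclideanSpace.single b 1) 2) →
      0 < r → 0 < δ → δ ≤ 1 / 4 →
      -- the STRAIGHT hot branch `s ↦ s • e` in frame form: horizontal unit direction, hot line, transversal curvature bound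
      e 2 = 0 → e 0 ^ 2 + e 1 ^ 2 = 1 →
      (∀ s : ℝ, U (-1) (frameCLM e (s, (0 : ℝ), (0 : ℝ))) 2 = U (-1) 0 2) →
      (∀ s : ℝ, κ ≤ -(fderiv ℝ (fderiv ℝ (fun y => σ * U (-1) y 2)) (frameCLM e (s, (0 : ℝ), (0 : ℝ))) (Jvec e) (Jvec e))) →
      -- (Q3∞), cold lateral values, hot centre, strict concavity, web Fermat law on the `δ`-box (frame form)
      (∀ τ z : ℝ, |τ| < δ → |z| < δ → ∀ s : ℝ,
        sSup ((fun n : ℝ => σ * U (-1 + τ) (frameCLM e (s, n, z)) 2) '' Set.Icc (-r) r) = R τ z) →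
      (∀ τ z : ℝ, |τ| < δ → |z| < δ → ∀ s n : ℝ, (n = r ∨ n = -r) → σ * U (-1 + τ) (frameCLM e (s, n, z)) 2 < m) →
      (∀ τ z : ℝ, |τ| < δ → |z| < δ → ∀ s : ℝ, m ≤ σ * U (-1 + τ) (frameCLM e (s, (0 : ℝ), z)) 2) →
      (∀ τ z : ℝ, |τ| < δ → |z| < δ → ∀ s : ℝ, ∀ n ∈ Set.Ioo (-r) r,
        fderiv ℝ (fderiv ℝ (fun y => σ * U (-1 + τ) y 2)) (frameCLM e (s, n, z)) (Jvec e) (Jvec e) < 0) →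
      (∀ τ₀ z₀ : ℝ, |τ₀| < δ → |z₀| < δ → ∀ s₀ : ℝ, ∃ n₀ ∈ Set.Ioo (-r) r,
        σ * U (-1 + τ₀) (frameCLM e (s₀, n₀, z₀)) 2 = R τ₀ z₀ ∧
        (∀ n ∈ Set.Icc (-r) r, n ≠ n₀ → σ * U (-1 + τ₀) (frameCLM e (s₀, n, z₀)) 2 < R τ₀ z₀) ∧
        DifferentiableAt ℝ (Function.uncurry R) (τ₀, z₀) ∧
        fderiv ℝ (Function.uncurry fun τ y => σ * U (-1 + τ) y 2) (τ₀, frameCLM e (s₀, n₀, z₀)) =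
          (fderiv ℝ (Function.uncurry R) (τ₀, z₀)).comp
            ((ContinuousLinearMap.fst ℝ ℝ (EuclideanSpace ℝ (Fin 3))).prod
              ((EuclideanSpace.proj (2 : Fin 3)).comp (ContinuousLinearMap.snd ℝ ℝ (EuclideanSpace ℝ (Fin 3)))))) →
      -- THE SPACE–TIME WEB PACKAGE on the `δ′`-box (`…Q4TimeWebPackage.time_web_package_line`), webs parallel at `τ = 0`, negative slope on the box
      0 < δ' → δ' ≤ δ → δ' ≤ ρ → δ' < 1 / 2 →
      (∀ q : ℝ × ℝ × ℝ, |q.1| < δ' → |q.2.2| < δ' →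
        n₀ q ∈ Set.Ioo (-r) r ∧
        σ * U (-1 + q.1) (frameCLM e (q.2.1, n₀ q, q.2.2)) 2 = R q.1 q.2.2 ∧
        (∀ n ∈ Set.Icc (-r) r, n ≠ n₀ q → σ * U (-1 + q.1) (frameCLM e (q.2.1, n, q.2.2)) 2 < R q.1 q.2.2) ∧
        (∀ w : EuclideanSpace ℝ (Fin 3), w 2 = 0 → fderiv ℝ (fun y => U (-1 + q.1) y 2) (frameCLM e (q.2.1, n₀ q, q.2.2)) w = 0) ∧
        (∀ m : ℕ∞, ContDiffAt ℝ m n₀ q) ∧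
        0 < κt q.1 q.2.2 ∧
        fderiv ℝ (fderiv ℝ (fun y => σ * U (-1 + q.1) y 2)) (frameCLM e (q.2.1, n₀ q, q.2.2)) e e +
            fderiv ℝ (fderiv ℝ (fun y => σ * U (-1 + q.1) y 2)) (frameCLM e (q.2.1, n₀ q, q.2.2)) (Jvec e) (Jvec e) =
          -κt q.1 q.2.2 ∧
        κt q.1 q.2.2 * (fderiv ℝ n₀ q ((0 : ℝ), (0 : ℝ), (1 : ℝ))) ^ 2 =
          (deriv (deriv (R q.1)) q.2.2 - μ (-1 + q.1) q.2.2 * κt q.1 q.2.2) * (1 + (fderiv ℝ n₀ q ((0 : ℝ), (1 : ℝ), (0 : ℝ))) ^ 2)) →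
      (∀ s z : ℝ, |z| < δ' → n₀ ((0 : ℝ), s, z) = n₀ ((0 : ℝ), (0 : ℝ), z)) →
      (∀ τ z : ℝ, |τ| < δ' → |z| < δ' → μ (-1 + τ) z < 0) →
      -- CASE II, SHARPENED (`…WebPackageAnalytic.eventually_nonsonic_of_package`): a PUNCTURED WINDOW of non-sonic times around `τ = 0` …
      (∃ δ'' : ℝ, 0 < δ'' ∧ ∀ τ : ℝ, 0 < |τ| → |τ| < δ'' → ¬ (∃ a b : ℝ, ∀ z : ℝ, |z| < δ → R τ z = a + b * z)) →
      -- … and at every non-sonic time of the box the base web is NOT an `e`-parallel line (the LINE lever `…LineLeverAtTime`)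
      (∀ τ : ℝ, |τ| < δ' → ¬ (∃ a b : ℝ, ∀ z : ℝ, |z| < δ → R τ z = a + b * z) →
        ∃ s : ℝ, n₀ (τ, s, (0 : ℝ)) ≠ n₀ (τ, (0 : ℝ), (0 : ℝ))) →
      False) :
    ∀ (C : ℝ) (v : ℝ → EuclideanSpace ℝ (Fin 3) → EuclideanSpace ℝ (Fin 3)) (W : Set (ℝ × EuclideanSpace ℝ (Fin 3))),
      (Literature.Analysis.FluidPDE.HasTypeITimeDecay C v ∧
        ContinuousOn (Function.uncurry v) (Set.Iio (0 : ℝ) ×ˢ Set.univ) ∧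
        (∀ s t : ℝ, s < t → t < 0 → ∀ x, v t x =
          Literature.Analysis.UnboundedOperators.heatExtension (v s) (t - s) x -
            Literature.Analysis.FluidPDE.oseenDuhamel 1 s v v t x) ∧
        (∀ t < 0, Literature.Analysis.FluidPDE.VectorCalculus.IsDivFree (v t)) ∧
        (∀ s < 0, ∀ y, ⟪Literature.Analysis.FluidPDE.curl (v s) y, EuclideanSpace.single 2 1⟫_ℝ = 0) ∧
        v (-1) 0 2 ≠ 0 ∧ (∀ t < 0, ∀ x, Real.sqrt (-t) * |v t x 2| ≤ |v (-1) 0 2|) ∧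
        (∀ h : EuclideanSpace ℝ (Fin 3), fderiv ℝ (v (-1)) 0 h 2 = 0) ∧
        (deriv (fun s => v s 0 2) (-1) = v (-1) 0 2 / 2 ∧ v (-1) 0 2 * (Δ (fun y => v (-1) y 2)) 0 ≤ 0)) →
      (IsOpen W ∧ W.Nonempty ∧ W ⊆ Set.Iio (0 : ℝ) ×ˢ Set.univ ∧
        (∀ z ∈ W, (Literature.Analysis.FluidPDE.curl (v z.1) z.2 ≠ 0 ∧
            (fderiv ℝ (v z.1) z.2 (EuclideanSpace.single 0 1) 2 ≠ 0 ∨ fderiv ℝ (v z.1) z.2 (EuclideanSpace.single 1 1) 2 ≠ 0) ∧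
            (fderiv ℝ (v z.1) z.2 (EuclideanSpace.single 2 1) 0 ≠ 0 ∨ fderiv ℝ (v z.1) z.2 (EuclideanSpace.single 2 1) 1 ≠ 0))) ∧
        (∀ m : ℝ → ℝ, ∀ W₁ : Set (ℝ × EuclideanSpace ℝ (Fin 3)), W₁ ⊆ W → IsOpen W₁ → W₁.Nonempty →
            ∃ z ∈ W₁, ∃ b : Fin 3, b ≠ 2 ∧
              fderiv ℝ (v z.1) z.2 (EuclideanSpace.single 2 1) b ≠
                m z.1 * fderiv ℝ (v z.1) z.2 (EuclideanSpace.single b 1) 2) ∧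
        (∀ z ∈ W, (fderiv ℝ (fun x => fderiv ℝ (v z.1) x (EuclideanSpace.single 2 1) 2) z.2 (EuclideanSpace.single 0 1) *
                fderiv ℝ (v z.1) z.2 (EuclideanSpace.single 1 1) 2 -
              fderiv ℝ (fun x => fderiv ℝ (v z.1) x (EuclideanSpace.single 2 1) 2) z.2 (EuclideanSpace.single 1 1) *
                fderiv ℝ (v z.1) z.2 (EuclideanSpace.single 0 1) 2 ≠ 0)) ∧
        (∃ m : ℝ → ℝ → ℝ, ∀ z ∈ W, ∀ b : Fin 3, b ≠ 2 →
            fderiv ℝ (v z.1) z.2 (EuclideanSpace.single 2 1) b =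
              m z.1 (z.2 2) * fderiv ℝ (v z.1) z.2 (EuclideanSpace.single b 1) 2)) →
      (∀ t < 0, ∀ x x' : EuclideanSpace ℝ (Fin 3), x 2 = x' 2 → ∀ b c : Fin 3, b ≠ 2 → c ≠ 2 →
        fderiv ℝ (v t) x (EuclideanSpace.single 2 1) b * fderiv ℝ (v t) x' (EuclideanSpace.single c 1) 2 =
          fderiv ℝ (v t) x' (EuclideanSpace.single 2 1) c * fderiv ℝ (v t) x (EuclideanSpace.single b 1) 2) →
      (∀ (s z₀ σ M : ℝ) (K O : Set (EuclideanSpace ℝ (Fin 3))), s < 0 →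
        ((σ = 1 ∨ σ = -1) ∧ IsCompact K ∧ K.Nonempty ∧ (∀ y ∈ K, y 2 = z₀ ∧ σ * v s y 2 = M) ∧
          IsOpen O ∧ K ⊆ O ∧ (∀ y ∈ O, y 2 = z₀ → σ * v s y 2 ≤ M) ∧
          (∀ y ∈ O, y 2 = z₀ → σ * v s y 2 = M → y ∈ K)) → False) →
      (∀ s < 0, ∀ y, ⟪fderiv ℝ (v s) y (Literature.Analysis.FluidPDE.curl (v s) y), EuclideanSpace.single 2 1⟫_ℝ = 0) →
      IsClosed ({y : EuclideanSpace ℝ (Fin 3) | y 2 = 0 ∧ v (-1) y 2 = v (-1) 0 2}) →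
      (∀ y ∈ {y : EuclideanSpace ℝ (Fin 3) | y 2 = 0 ∧ v (-1) y 2 = v (-1) 0 2}, fderiv ℝ (fun x => v (-1) x 2) y = 0) →
      (∀ K O : Set (EuclideanSpace ℝ (Fin 3)), IsCompact K → K.Nonempty → K ⊆ {y : EuclideanSpace ℝ (Fin 3) | y 2 = 0 ∧ v (-1) y 2 = v (-1) 0 2} →
        IsOpen O → K ⊆ O → O ∩ {y : EuclideanSpace ℝ (Fin 3) | y 2 = 0 ∧ v (-1) y 2 = v (-1) 0 2} ⊆ K → False) →
      (∀ y ∈ {y : EuclideanSpace ℝ (Fin 3) | y 2 = 0 ∧ v (-1) y 2 = v (-1) 0 2}, ∀ r : ℝ, 0 < r →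
        ∃ y' : EuclideanSpace ℝ (Fin 3), y' 2 = 0 ∧ dist y' y < r ∧ v (-1) y' 2 ≠ v (-1) 0 2) →
      (∀ y ∈ {y : EuclideanSpace ℝ (Fin 3) | y 2 = 0 ∧ v (-1) y 2 = v (-1) 0 2}, Literature.Analysis.FluidPDE.curl (v (-1)) y = 0) →
      ∀ (σ κ : ℝ) (y₁ : EuclideanSpace ℝ (Fin 3)) (c₁ : Fin 3), (σ = 1 ∨ σ = -1) → σ * v (-1) 0 2 = |v (-1) 0 2| → 0 < κ →
        (∀ y : EuclideanSpace ℝ (Fin 3), y 2 = 0 → v (-1) y 2 = v (-1) 0 2 →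
          fderiv ℝ (fderiv ℝ (fun x => σ * v (-1) x 2)) y (EuclideanSpace.single 0 1) (EuclideanSpace.single 0 1) +
            fderiv ℝ (fderiv ℝ (fun x => σ * v (-1) x 2)) y (EuclideanSpace.single 1 1) (EuclideanSpace.single 1 1) = -κ) →
        y₁ 2 = 0 → c₁ ≠ 2 → fderiv ℝ (v (-1)) y₁ (EuclideanSpace.single c₁ 1) 2 ≠ 0 →
        (∃ (γ : ℝ → EuclideanSpace ℝ (Fin 3)) (φ : ℕ → ℕ) (U : ℝ → EuclideanSpace ℝ (Fin 3) → EuclideanSpace ℝ (Fin 3)) (Γ νΓ : ℝ → EuclideanSpace ℝ (Fin 3))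
        (F : ℝ → EuclideanSpace ℝ (Fin 3) → ℝ) (R : ℝ → ℝ → ℝ) (r δ m : ℝ) (μ : ℝ → ℝ → ℝ) (ρ : ℝ),
        -- the complete hot branch of BRANCH-PARAM (LEAD g15 `exists_complete_hotBranch_of_ridge`)
        ((ContDiff ℝ 2 γ ∧ γ 0 = 0 ∧ (∀ s, γ s 2 = 0) ∧ (∀ s, ‖deriv γ s‖ = 1) ∧ (∀ s, v (-1) (γ s) 2 = v (-1) 0 2) ∧
          (∀ s, fderiv ℝ (fderiv ℝ (fun y => σ * v (-1) y 2)) (γ s) (WithLp.toLp 2 ![-(deriv γ s 1), deriv γ s 0, 0])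
            (WithLp.toLp 2 ![-(deriv γ s 1), deriv γ s 0, 0]) = -κ) ∧
          (∀ s w, fderiv ℝ (fderiv ℝ (fun y => σ * v (-1) y 2)) (γ s) (deriv γ s) w = 0)) ∧ StrictMono φ ∧
        -- the hull limit (pinned, peakless, same hot value), slices converging locally uniformly, re-based branches converging to `Γ`
        (Literature.Analysis.FluidPDE.HasTypeITimeDecay C U ∧
          ContinuousOn (Function.uncurry U) (Set.Iio (0 : ℝ) ×ˢ Set.univ) ∧
          (∀ s t : ℝ, s < t → t < 0 → ∀ x, U t x =
            Literature.Analysis.UnboundedOperators.heatExtension (U s) (t - s) x -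
              Literature.Analysis.FluidPDE.oseenDuhamel 1 s U U t x) ∧
          (∀ t < 0, Literature.Analysis.FluidPDE.VectorCalculus.IsDivFree (U t)) ∧
          (∀ s < 0, ∀ q, ⟪Literature.Analysis.FluidPDE.curl (U s) q, EuclideanSpace.single 2 1⟫_ℝ = 0) ∧
          U (-1) 0 2 ≠ 0 ∧ (∀ t < 0, ∀ x, Real.sqrt (-t) * |U t x 2| ≤ |U (-1) 0 2|) ∧
          (∀ h : EuclideanSpace ℝ (Fin 3), fderiv ℝ (U (-1)) 0 h 2 = 0) ∧
          (deriv (fun s => U s 0 2) (-1) = U (-1) 0 2 / 2 ∧ U (-1) 0 2 * (Δ (fun q => U (-1) q 2)) 0 ≤ 0)) ∧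
        (∀ (s z₀ σ M : ℝ) (K O : Set (EuclideanSpace ℝ (Fin 3))), s < 0 →
          ((σ = 1 ∨ σ = -1) ∧ IsCompact K ∧ K.Nonempty ∧ (∀ q ∈ K, q 2 = z₀ ∧ σ * U s q 2 = M) ∧
            IsOpen O ∧ K ⊆ O ∧ (∀ q ∈ O, q 2 = z₀ → σ * U s q 2 ≤ M) ∧
            (∀ q ∈ O, q 2 = z₀ → σ * U s q 2 = M → q ∈ K)) → False) ∧
        U (-1) 0 2 = v (-1) 0 2 ∧
        (∀ t < 0, TendstoLocallyUniformly (fun j x => v t (x + γ ((φ j : ℕ) : ℝ))) (U t) atTop) ∧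
        (∀ s, Tendsto (fun j => γ (((φ j : ℕ) : ℝ) + s) - γ ((φ j : ℕ) : ℝ)) atTop (𝓝 (Γ s))) ∧
        -- re-entry package of the limit branch
        (∀ y ∈ {y : EuclideanSpace ℝ (Fin 3) | y 2 = 0 ∧ U (-1) y 2 = U (-1) 0 2}, fderiv ℝ (fun x => U (-1) x 2) y = 0) ∧
        ContDiff ℝ ∞ Γ ∧ Γ 0 = 0 ∧ (∀ s, Γ s 2 = 0) ∧ (∀ s, ‖deriv Γ s‖ = 1) ∧ (∀ s, U (-1) (Γ s) 2 = U (-1) 0 2) ∧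
        (∀ s, νΓ s = WithLp.toLp 2 ![-(deriv Γ s 1), deriv Γ s 0, 0]) ∧
        (∀ s, κ ≤ -(fderiv ℝ (fderiv ℝ (fun y => σ * U (-1) y 2)) (Γ s) (νΓ s) (νΓ s))) ∧
        -- the signed space–time component, the homogeneous ridge height, the tube radius, the window, the level
        (F = fun τ y => σ * U (-1 + τ) y 2) ∧
        (∀ τ z, R τ z = sSup ((fun n : ℝ => F τ (Γ 0 + n • νΓ 0 + z • EuclideanSpace.single 2 (1 : ℝ))) '' Icc (-r) r)) ∧
        0 < r ∧ 0 < δ ∧ δ ≤ 1 / 4 ∧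
        -- (Q3∞): the cross-section maximum is homogeneous along `Γ`
        (∀ τ z : ℝ, |τ| < δ → |z| < δ → ∀ s : ℝ,
          sSup ((fun n : ℝ => F τ (Γ s + n • νΓ s + z • EuclideanSpace.single 2 (1 : ℝ))) '' Icc (-r) r) = R τ z) ∧
        -- cold lateral values, hot centre
        (∀ τ z : ℝ, |τ| < δ → |z| < δ → ∀ s n : ℝ, (n = r ∨ n = -r) → F τ (Γ s + n • νΓ s + z • EuclideanSpace.single 2 (1 : ℝ)) < m) ∧
        (∀ τ z : ℝ, |τ| < δ → |z| < δ → ∀ s : ℝ, m ≤ F τ (Γ s + z • EuclideanSpace.single 2 (1 : ℝ))) ∧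
        -- strict concavity of the cross-sections on the open tube
        (∀ τ z : ℝ, |τ| < δ → |z| < δ → ∀ s : ℝ, ∀ n ∈ Ioo (-r) r,
          fderiv ℝ (fderiv ℝ (F τ)) (Γ s + n • νΓ s + z • EuclideanSpace.single 2 (1 : ℝ)) (νΓ s) (νΓ s) < 0) ∧
        -- THE WEB FERMAT LAW at every cross-section
        (∀ τ₀ z₀ : ℝ, |τ₀| < δ → |z₀| < δ → ∀ s₀ : ℝ, ∃ n₀ ∈ Ioo (-r) r,
          F τ₀ (Γ s₀ + n₀ • νΓ s₀ + z₀ • EuclideanSpace.single 2 (1 : ℝ)) = R τ₀ z₀ ∧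
          (∀ n ∈ Icc (-r) r, n ≠ n₀ → F τ₀ (Γ s₀ + n • νΓ s₀ + z₀ • EuclideanSpace.single 2 (1 : ℝ)) < R τ₀ z₀) ∧
          DifferentiableAt ℝ (uncurry R) (τ₀, z₀) ∧
          fderiv ℝ (uncurry F) (τ₀, Γ s₀ + n₀ • νΓ s₀ + z₀ • EuclideanSpace.single 2 (1 : ℝ)) =
            (fderiv ℝ (uncurry R) (τ₀, z₀)).comp
              ((ContinuousLinearMap.fst ℝ ℝ (EuclideanSpace ℝ (Fin 3))).prod
                ((EuclideanSpace.proj (2 : Fin 3)).comp (ContinuousLinearMap.snd ℝ ℝ (EuclideanSpace ℝ (Fin 3)))))) ∧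
        -- (TH) STRUCTURE OF THE HULL ELEMENT: the global bilinear identity, the frozen law, and the slope function of `v` on a uniform slab — the SAME `μ` for `U`
        (∀ t < 0, ∀ x x' : EuclideanSpace ℝ (Fin 3), x 2 = x' 2 → ∀ b c : Fin 3, b ≠ 2 → c ≠ 2 →
          fderiv ℝ (U t) x (EuclideanSpace.single 2 1) b * fderiv ℝ (U t) x' (EuclideanSpace.single c 1) 2 =
            fderiv ℝ (U t) x' (EuclideanSpace.single 2 1) c * fderiv ℝ (U t) x (EuclideanSpace.single b 1) 2) ∧
        (∀ s < 0, ∀ y, ⟪fderiv ℝ (U s) y (Literature.Analysis.FluidPDE.curl (U s) y), EuclideanSpace.single 2 1⟫_ℝ = 0) ∧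
        0 < ρ ∧ ρ ≤ 1 ∧ ContDiff ℝ 3 (uncurry μ) ∧
        μ (-1) 0 = fderiv ℝ (v (-1)) y₁ (EuclideanSpace.single 2 1) c₁ / fderiv ℝ (v (-1)) y₁ (EuclideanSpace.single c₁ 1) 2 ∧
        (∀ t : ℝ, |t + 1| < ρ → ∀ x : EuclideanSpace ℝ (Fin 3), |x 2| < ρ → ∀ b : Fin 3, b ≠ 2 →
          fderiv ℝ (v t) x (EuclideanSpace.single 2 1) b = μ t (x 2) * fderiv ℝ (v t) x (EuclideanSpace.single b 1) 2) ∧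
        (∀ t : ℝ, |t + 1| < ρ → ∀ x : EuclideanSpace ℝ (Fin 3), |x 2| < ρ → ∀ b : Fin 3, b ≠ 2 →
          fderiv ℝ (U t) x (EuclideanSpace.single 2 1) b = μ t (x 2) * fderiv ℝ (U t) x (EuclideanSpace.single b 1) 2) ∧
        (∀ t₀ : ℝ, |t₀ + 1| < ρ → ∀ y₀ : EuclideanSpace ℝ (Fin 3), y₀ 2 = 0 →
          ∀ᶠ z in 𝓝 ((t₀, y₀) : ℝ × EuclideanSpace ℝ (Fin 3)), ∀ b : Fin 3, b ≠ 2 →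
            fderiv ℝ (U z.1) z.2 (EuclideanSpace.single 2 1) b = μ z.1 (z.2 2) * fderiv ℝ (U z.1) z.2 (EuclideanSpace.single b 1) 2)) ∧
        -- (v9) the sub-cell
        (∃ a b : ℝ, ∀ z : ℝ, |z| < δ → R 0 z = a + b * z) ∧
        -- (v11) the sub-sub-cell: straight branch, non-vanishing (hence negative) slope at the hot spot
        (∀ s : ℝ, Γ s = s • deriv Γ 0) ∧ ¬ (μ (-1) 0 = 0) ∧
        -- (v14) CASE II: the sonic time τ = 0 is isolated (research: curved s-modulated webs at nearby non-sonic times)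
        (¬ (∃ δ' : ℝ, 0 < δ' ∧ ∀ τ : ℝ, |τ| < δ' → ∃ a b : ℝ, ∀ z : ℝ, |z| < δ → R τ z = a + b * z))) →
        False := by
  refine caseII_false_of_curvedEnd ?_
  intro C σ κ ρ δ' r δ m U R μ e n₀ κt hUrate hUcont hUmild hUdiv hUpol hUne hUhotbd hUflat hUtime hUpeak hUcrit hbil hUcurl
    hσ hσN hκ hμ3 hρ hρ1 hslabU hevU hr hδ hδ4 he2 hunit hhotline hcurvF hQ3F hcoldF hhotF hconcF hwebF hδ'pos hδ'δ hδ'ρ hδ'h hpack hpar0 hμnegB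
    hiso hunpin
  -- the punctured window of non-sonic times
  have hδh : δ ≤ 1 / 2 := by linarith
  have hweb2 : ∀ τ z : ℝ, |τ| < δ → |z| < δ → ∀ s : ℝ, ∃ n₁ ∈ Ioo (-r) r, σ * U (-1 + τ) (frameCLM e (s, n₁, z)) 2 = R τ z ∧
      ∀ n ∈ Icc (-r) r, n ≠ n₁ → σ * U (-1 + τ) (frameCLM e (s, n, z)) 2 < R τ z := by
    intro τ z hτ hz s
    obtain ⟨n₁, hn₁, h1, h2, -, -⟩ := hwebF τ z hτ hz s
    exact ⟨n₁, hn₁, h1, h2⟩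
  have hiso' : ¬ (∃ δ₁ : ℝ, 0 < δ₁ ∧ ∀ τ : ℝ, |τ| < δ₁ → ∃ a b : ℝ, ∀ z : ℝ, |z| < δ → R τ z = a + b * z) := by
    rintro ⟨δ₁, hδ₁, hall⟩
    obtain ⟨τ, hτ, hn⟩ := hiso δ₁ hδ₁
    exact hn (hall τ hτ)
  have hsharp := eventually_nonsonic_of_package hUrate hUcont hUmild hUdiv hδ hδh hconcF hweb2 hiso'
  exact hCurvedEnd' C σ κ ρ δ' r δ m U R μ e n₀ κt hUrate hUcont hUmild hUdiv hUpol hUne hUhotbd hUflat hUtime hUpeak hUcrit hbil hUcurl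
    hσ hσN hκ hμ3 hρ hρ1 hslabU hevU hr hδ hδ4 he2 hunit hhotline hcurvF hQ3F hcoldF hhotF hconcF hwebF hδ'pos hδ'δ hδ'ρ hδ'h hpack hpar0 hμnegB
    hsharp hunpin

end Summit.NavierStokesRegularity.NavierStokesRegularity.Theorems.PoloidalWindowDoorLrcModEntireCaseIIEntranceSharp

end
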